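import Summits.QuantumAdvantage.QuantumAdvantage.Theorems.CubicForrelationNearExactIsExactTwoModSixSecondCheapWild

/-!
# Crux `CubicForrelation.NearExactIsExact` (stmt-QuantumAdvantage-14043) — `n = 6r+2`, the all-cheap type-O branch at the second boundary:
  the wild part is squeezed, `2ⁿ − 4 ≤ Σ D² ≤ 4·2ⁿ/3` and `Σ (−1)^{d₁} D ≤ 0` (`r ≥ 2`, uniform in `r`)

Certificate seat `b2b-cforr-cert` (gen 9).  HONEST FRAMING: quantitative constraints on one residual branch of the certified case list
(`second_boundary_side_two_mod_six`: type O, rank `d₁ ≤ 2`, every point cheap) when the partner is also of type O; NOT a kill of the branch,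
NOT summit progress.

With `τ_g = u − 2^r(−1)^f = (−1)^{d₁} + D`, `D ≡ 0 (mod 8)` pointwise (cheapness): the budget `Στ_g² = 2^{8r+3}(1 − Φ) ≤ 2·2ⁿ` (`tms_budget`)
reads `2ⁿ + 2Σ(−1)^{d₁}D + ΣD² ≤ 2·2ⁿ`; the wild mass `ΣD² ≥ 2ⁿ − 4` (`tm2_cheap_wild_mass`, partner of type O) then forces
`Σ(−1)^{d₁}D ≤ 2`, hence `≤ 0` (a multiple of `8`), and `|Σ(−1)^{d₁}D| ≤ ΣD²/8` gives `ΣD² ≤ 4·2ⁿ/3`.  `tm2_cheap_squeeze`.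

References: as in the imported files.  Everything below is proved from the tree; axioms are the standard three.
-/

set_option linter.dupNamespace false -- D-0017: single-problem summit ⇒ `QuantumAdvantage.QuantumAdvantage` by design

noncomputable section

namespace Summit.QuantumAdvantage.QuantumAdvantage.Theorems.CubicForrelation.NearExactIsExact

open Finset
open Literature.Computability.QuantumComplexity
open Literature.Computability.QuantumComplexity.DerivativeWalsh (W)

/-- **The squeeze on the wild part** (`n = 6r+2`, `r ≥ 2`; `g` cubic of type O with every point cheap, partner `f` with `W_f = 2^{2r+1}v`, `v` odd,
and `Φ(f,g) ≥ 1 − (1/2)^{2r}`).  With `D(x) := u(x) − 2^r(−1)^{f(x)} − (−1)^{d₁(x)}`:  `Σ_x (−1)^{d₁(x)} D(x) ≤ 0` and `3·Σ_x D(x)² ≤ 4·2ⁿ`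
(and `Σ D² ≥ 2ⁿ − 4` by `tm2_cheap_wild_mass`).  NOT a kill of the branch; NOT summit progress. [this work] -/
theorem tm2_cheap_squeeze (r : ℕ) (hr : 2 ≤ r) (f g : (Fin ((3 * r + 1) + (3 * r + 1)) → Bool) → Bool) (hg : IsDegLeFun 3 g)
    (u v : (Fin ((3 * r + 1) + (3 * r + 1)) → Bool) → ℤ)
    (hu : ∀ x, W (fun y => signOf (g y)) x = (2 : ℝ) ^ (2 * r + 1) * (u x : ℝ))
    (hv : ∀ y, W (fun x => signOf (f x)) y = (2 : ℝ) ^ (2 * r + 1) * (v y : ℝ)) (hvodd : ∀ y, Odd (v y))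
    (hcheap : ∀ x, (8 : ℤ) ∣ u x - 2 ^ r - 1 ∨ (8 : ℤ) ∣ u x - 2 ^ r + 1)
    (hΦ : 1 - (1 / 2 : ℝ) ^ (2 * r) ≤ forrelation f g) :
    (∑ x, sZ (decide (Odd (u x / 2))) * (u x - 2 ^ r * sZ (f x) - sZ (decide (Odd (u x / 2)))) : ℤ) ≤ 0 ∧
      3 * (∑ x, (u x - 2 ^ r * sZ (f x) - sZ (decide (Odd (u x / 2)))) ^ 2 : ℤ) ≤ 4 * 2 ^ ((3 * r + 1) + (3 * r + 1)) := by
  classical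
  have h4 : (2 : ℤ) ^ r = 4 * 2 ^ (r - 2) := by
    rw [show (4 : ℤ) = 2 ^ 2 by norm_num, ← pow_add]; congr 1; omega
  have hodd : ∀ x, Odd (u x) := by
    intro x
    rw [Int.odd_iff]
    rcases hcheap x with h | h <;> omega
  -- `D ≡ 0 (mod 8)` pointwise
  have hD8 : ∀ x, (8 : ℤ) ∣ u x - 2 ^ r * sZ (f x) - sZ (decide (Odd (u x / 2))) := by
    intro x
    have hux := Int.odd_iff.1 (hodd x)
    rcases tp_sZ_cases (f x) with hs | hs <;> rw [hs]
    · by_cases ho : Odd (u x / 2)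
      · have ho' := Int.odd_iff.1 ho
        rw [decide_eq_true ho, show sZ true = -1 from rfl]
        rcases hcheap x with h | h <;> omega
      · have ho' := Int.not_odd_iff_even.1 ho
        rw [Int.even_iff] at ho'
        rw [decide_eq_false ho, show sZ false = 1 from rfl]
        rcases hcheap x with h | h <;> omega
    · by_cases ho : Odd (u x / 2)
      · have ho' := Int.odd_iff.1 ho
        rw [decide_eq_true ho, show sZ true = -1 from rfl]
        rcases hcheap x with h | h <;> omega
      · have ho' := Int.not_odd_iff_even.1 ho
        rw [Int.even_iff] at ho'
        rw [decide_eq_false ho, show sZ false = 1 from rfl]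
        rcases hcheap x with h | h <;> omega
  -- budget `Σ τ² ≤ 2N`
  have hNZ : (2 : ℤ) ^ ((3 * r + 1) + (3 * r + 1)) = 2 ^ (6 * r + 2) := by congr 1; ring
  have hbud := tms_budget r f g u hu
  have hT : (∑ x, (u x - 2 ^ r * sZ (f x)) ^ 2 : ℤ) ≤ 2 * 2 ^ (6 * r + 2) := by
    have hpow : (2 : ℝ) ^ (8 * r + 3) * (1 / 2) ^ (2 * r) = 2 * 2 ^ (6 * r + 2) := by
      rw [one_div_pow]; field_simp; ring
    have h1 : 1 - forrelation f g ≤ (1 / 2 : ℝ) ^ (2 * r) := by linarith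
    have h' : ((∑ x, (u x - 2 ^ r * sZ (f x)) ^ 2 : ℤ) : ℝ) ≤ 2 * (2 : ℝ) ^ (6 * r + 2) := by
      rw [hbud, ← hpow]
      exact mul_le_mul_of_nonneg_left h1 (by positivity)
    exact_mod_cast h'
  -- wild mass `Σ D² ≥ N − 4`
  have hwild := tm2_cheap_wild_mass r hr f g hg u v hu hv hvodd hcheap
  have hW : 2 ^ (6 * r + 2) - 4 ≤ (∑ x, (u x - 2 ^ r * sZ (f x) - sZ (decide (Odd (u x / 2)))) ^ 2 : ℤ) := by
    have h' : (2 : ℝ) ^ (6 * r + 2) - 4 ≤ (((∑ x, (u x - 2 ^ r * sZ (f x) - sZ (decide (Odd (u x / 2)))) ^ 2 : ℤ)) : ℝ) := by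
      rw [show 6 * r + 2 = (3 * r + 1) + (3 * r + 1) by ring]
      refine hwild.trans (le_of_eq ?_)
      push_cast
      refine sum_congr rfl fun x _ => ?_
      rw [tp_sZ_cast, tp_sZ_cast]
    exact_mod_cast h'
  -- expand `τ² = 1 + 2εD + D²`
  set D : (Fin ((3 * r + 1) + (3 * r + 1)) → Bool) → ℤ := fun x => u x - 2 ^ r * sZ (f x) - sZ (decide (Odd (u x / 2))) with hDdef
  have hε2 : ∀ x, sZ (decide (Odd (u x / 2))) ^ 2 = 1 := fun x => by rcases tp_sZ_cases (decide (Odd (u x / 2))) with h | h <;> rw [h] <;> norm_num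
  have hexp : ∀ x, (u x - 2 ^ r * sZ (f x)) ^ 2 = 1 + 2 * (sZ (decide (Odd (u x / 2))) * D x) + D x ^ 2 := by
    intro x
    have e : u x - 2 ^ r * sZ (f x) = sZ (decide (Odd (u x / 2))) + D x := by simp only [D]; ring
    rw [e]; nlinarith [hε2 x]
  have hNcard : #(univ : Finset (Fin ((3 * r + 1) + (3 * r + 1)) → Bool)) = 2 ^ (6 * r + 2) := by
    rw [card_univ, Fintype.card_fun, Fintype.card_bool, Fintype.card_fin]; congr 1; ring
  have hsumT : (∑ x, (u x - 2 ^ r * sZ (f x)) ^ 2 : ℤ) =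
      2 ^ (6 * r + 2) + 2 * ∑ x, sZ (decide (Odd (u x / 2))) * D x + ∑ x, D x ^ 2 := by
    rw [sum_congr rfl fun x _ => hexp x, sum_add_distrib, sum_add_distrib, sum_const, hNcard, ← mul_sum, nsmul_eq_mul, mul_one]
    push_cast; ring
  have hW' : 2 ^ (6 * r + 2) - 4 ≤ ∑ x, D x ^ 2 := hW
  -- (a) the correlation is `≤ 2`, hence `≤ 0`
  have hcorr2 : ∑ x, sZ (decide (Odd (u x / 2))) * D x ≤ 2 := by linarith
  have hcorr8 : (8 : ℤ) ∣ ∑ x, sZ (decide (Odd (u x / 2))) * D x :=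
    dvd_sum fun x _ => Dvd.dvd.mul_left (hD8 x) _
  have hcorr : ∑ x, sZ (decide (Odd (u x / 2))) * D x ≤ 0 := by
    obtain ⟨m, hm⟩ := hcorr8; rw [hm] at hcorr2 ⊢; omega
  -- (b) `|Σ εD| ≤ Σ D²/8`
  have habs : -(∑ x, D x ^ 2) ≤ 8 * ∑ x, sZ (decide (Odd (u x / 2))) * D x := by
    rw [mul_sum, ← sum_neg_distrib]
    refine sum_le_sum fun x _ => ?_
    have h8 := hD8 x
    have hDx : D x = u x - 2 ^ r * sZ (f x) - sZ (decide (Odd (u x / 2))) := rfl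
    rw [← hDx] at h8
    obtain ⟨m, hm⟩ := h8
    have hsq1 := Int.le_self_sq m
    have hsq2 := Int.le_self_sq (-m)
    rcases tp_sZ_cases (decide (Odd (u x / 2))) with h | h <;> rw [h, hm] <;> nlinarith
  refine ⟨hcorr, ?_⟩
  have : 3 * ∑ x, D x ^ 2 ≤ 4 * 2 ^ (6 * r + 2) := by linarith
  rw [hNZ]
  exact this

end Summit.QuantumAdvantage.QuantumAdvantage.Theorems.CubicForrelation.NearExactIsExact

end
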